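import Mathlib
import Summits.Ventures.HodgeRepro.Tier4.Common.AdelicDefs
import Summits.Ventures.HodgeRepro.Tier4.Line1.RationalPoints
import Summits.Ventures.HodgeRepro.Tier4.Line1.CocompactReduction

/-!
# Tier4/Line1/TorusConjugation — (I1-c″) from (I1-c′) when `T′` is a rational conjugate of `T`

Blind re-derivation cell `pub-hodge-repro`, Tier 4 (README §9–§10), seat t4-L1-p5 (prover, LINE L1, gen 0).
LINE L1's second torus is `T′ = g (U(W₂) × U(W₃)) g⁻¹` (Skeleton, STRATEGY): when the projectors `Q i` of `T′` are the
conjugates `g (P i) g⁻¹` of the projectors of `T` by a RATIONAL point `g ∈ U(W)(k)` (hypothesis `hQ`, stated on the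
adelic matrices), the DEFINED `torusT' W` is the conjugate subgroup `g (torusT W) g⁻¹`, rational points go to rational
points, and the cocompactness residual R-c″ of `proofs/t4/L1/I1-c-CENSUS.md` follows from R-c′ by transport along the
homeomorphism `x ↦ g x g⁻¹`; with `Tier4/Line1/CocompactReduction.lean` this gives (I1-c″) from R-c′.  So under this
hypothesis the residual family of the instance section is R-c and R-c′ only.

Nothing here says anything about the status of the Hodge conjecture for CM abelian varieties, which is NOT proved
(HC_CM is NOT proved by anyone in this repository).
-/

set_option autoImplicit false

noncomputable section

namespace Summit.Ventures.HodgeRepro.Tier4.Line1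

open NumberField Common MeasureTheory Topology

section Instance

variable {k : Type} [Field k] [NumberField k] (W : PlaneData k)

/-- The commutant of a conjugate `g A g⁻¹` (adelically) is the conjugate of the commutant. -/
theorem mem_commutant_of_conj (g h : GA W) (A A' : Matrix (Fin 4) (Fin 4) k)
    (hA : adMat k A' = GA.mat W g * adMat k A * GA.mat W g⁻¹) :
    h ∈ commutant W A' ↔ g⁻¹ * h * g ∈ commutant W A := by
  have hMN : GA.mat W g * GA.mat W g⁻¹ = 1 := GA.mat_mul_inv W g
  have hNM : GA.mat W g⁻¹ * GA.mat W g = 1 := GA.mat_inv_mul W g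
  have e : GA.mat W (g⁻¹ * h * g) = GA.mat W g⁻¹ * GA.mat W h * GA.mat W g := rfl
  show GA.mat W h * adMat k A' = adMat k A' * GA.mat W h ↔
    GA.mat W (g⁻¹ * h * g) * adMat k A = adMat k A * GA.mat W (g⁻¹ * h * g)
  rw [e, hA]
  set M := GA.mat W g
  set N := GA.mat W g⁻¹
  set H := GA.mat W h
  set X := adMat k A
  constructor
  · intro hc
    calc N * H * M * X = N * H * M * X * (N * M) := by rw [hNM, Matrix.mul_one]
      _ = N * (H * (M * X * N)) * M := by simp only [Matrix.mul_assoc]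
      _ = N * (M * X * N * H) * M := by rw [hc]
      _ = (N * M) * X * (N * H * M) := by simp only [Matrix.mul_assoc]
      _ = X * (N * H * M) := by rw [hNM, Matrix.one_mul]
  · intro hc
    calc H * (M * X * N) = (M * N) * H * (M * X * N) := by rw [hMN, Matrix.one_mul]
      _ = M * (N * H * M * X) * N := by simp only [Matrix.mul_assoc]
      _ = M * (X * (N * H * M)) * N := by rw [hc]
      _ = M * X * N * H * (M * N) := by simp only [Matrix.mul_assoc]
      _ = M * X * N * H := by rw [hMN, Matrix.mul_one]

/-- If the projectors of `T′` are the conjugates of those of `T` by `g`, then `T′ = g T g⁻¹`. -/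
theorem mem_torusT'_iff_conj (g : GA W)
    (hQ : ∀ i, adMat k (W.Q i) = GA.mat W g * adMat k (W.P i) * GA.mat W g⁻¹) (h : GA W) :
    h ∈ torusT' W ↔ g⁻¹ * h * g ∈ torusT W := by
  unfold torusT' torusT
  rw [Subgroup.mem_inf, Subgroup.mem_inf, mem_commutant_of_conj W g h _ _ (hQ 0),
    mem_commutant_of_conj W g h _ _ (hQ 1)]

/-- **R-c′ ⇒ R-c″** when `T′ = g T g⁻¹` for a rational `g`: cocompactness of the rational points transports along
`x ↦ g x g⁻¹`. -/
theorem cocompact_torusT'_of_torusT (g : rationalPoints W)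
    (hQ : ∀ i, adMat k (W.Q i) = GA.mat W g * adMat k (W.P i) * GA.mat W (g : GA W)⁻¹)
    (h : ∃ C : Set (torusT W), IsCompact C ∧
      ∀ x : torusT W, ∃ γ : rationalOf W (torusT W), ∃ c ∈ C, x = (γ : torusT W) * c) :
    ∃ C' : Set (torusT' W), IsCompact C' ∧
      ∀ y : torusT' W, ∃ γ' : rationalOf W (torusT' W), ∃ c' ∈ C', y = (γ' : torusT' W) * c' := by
  obtain ⟨C, hC, hcov⟩ := h
  have hmem : ∀ x : torusT W, (g : GA W) * x * (g : GA W)⁻¹ ∈ torusT' W := fun x => by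
    rw [mem_torusT'_iff_conj W (g : GA W) hQ]
    have : ((g : GA W)⁻¹ * ((g : GA W) * x * (g : GA W)⁻¹) * (g : GA W)) = (x : GA W) := by group
    rw [this]
    exact x.2
  let φ : torusT W → torusT' W := fun x => ⟨(g : GA W) * x * (g : GA W)⁻¹, hmem x⟩
  have hφ : Continuous φ :=
    Continuous.subtype_mk ((continuous_const.mul continuous_subtype_val).mul continuous_const) _
  refine ⟨φ '' C, hC.image hφ, ?_⟩
  intro y
  have hy : (g : GA W)⁻¹ * y * (g : GA W) ∈ torusT W := (mem_torusT'_iff_conj W (g : GA W) hQ y).1 y.2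
  obtain ⟨γ, c, hc, hx⟩ := hcov ⟨(g : GA W)⁻¹ * y * (g : GA W), hy⟩
  have hγ' : (φ (γ : torusT W) : GA W) ∈ rationalPoints W := by
    show (g : GA W) * (γ : torusT W) * (g : GA W)⁻¹ ∈ rationalPoints W
    exact mul_mem (mul_mem g.2 γ.2) (inv_mem g.2)
  refine ⟨⟨φ (γ : torusT W), hγ'⟩, φ c, ⟨c, hc, rfl⟩, ?_⟩
  apply Subtype.ext
  have hx' : (g : GA W)⁻¹ * y * (g : GA W) = (γ : torusT W) * c := congrArg Subtype.val hx
  show (y : GA W) = ((g : GA W) * (γ : torusT W) * (g : GA W)⁻¹) * ((g : GA W) * c * (g : GA W)⁻¹)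
  have : (y : GA W) = (g : GA W) * ((g : GA W)⁻¹ * y * (g : GA W)) * (g : GA W)⁻¹ := by group
  rw [this, hx']
  group

/-- (I1-c″) from R-c′ under the conjugation hypothesis (through the landed reduction). -/
theorem torus'_quotient_compact_of_torus_cocompact [MeasurableSpace (GA W)] [BorelSpace (GA W)]
    (μT' : Measure (torusT' W)) (g : rationalPoints W)
    (hQ : ∀ i, adMat k (W.Q i) = GA.mat W g * adMat k (W.P i) * GA.mat W (g : GA W)⁻¹)
    (h : ∃ C : Set (torusT W), IsCompact C ∧
      ∀ x : torusT W, ∃ γ : rationalOf W (torusT W), ∃ c ∈ C, x = (γ : torusT W) * c) :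
    ∃ D : Set (torusT' W), IsFundamentalDomain (rationalOf W (torusT' W)) D μT' ∧ IsCompact (closure D) :=
  torus'_quotient_compact_of_cocompact W μT' (cocompact_torusT'_of_torusT W g hQ h)

end Instance

end Summit.Ventures.HodgeRepro.Tier4.Line1

end
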